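import Mathlib

/-!
# PER-LAYER DOMINANCE ON TWO UNIFORM FLATS — THE LEMMAS (night-3 g27)

`proofs/NIGHT3-G27-PLD.md` §2.  Two uniform flats `U_{s₁,F₁} ⊕ U_{s₂,F₂}` (no free points) with a kept-point selector per
flat (`J X ⊆ X`, `#J X = min #X s`).  A pair is `(I, D)`, `D ⊆ J(F ∖ I)`; `c = min #I s`, `f = min #(F ∖ I) s`, `δ = #D`;
a flat OVERFLOWS when `c + δ > s`.  This module: the set-theoretic basics (`card_sdiff_sdiff_eq`,
`sdiff_sdiff_sdiff_eq_union`, complement cancellation `eq_of_sdiff_sdiff_eq`, heredity `kept_of_subset`), the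
arithmetic of a residual source overflowing on one flat (`residual_facts`: the partner has room `#I_p + o + δ_p < s_p`,
`2#I_p + o + δ_p < #F_p`, `o = c_o + δ_o − f_o ≥ 1`), and the three MEMBERSHIP lemmas of the injection of
`C025ProfileTwoFlatPLD`: the complemented part of a non-overflowing flat (`N_flat`), the S-image «keep the overflowing
flat, complement the partner around an absorber `Y` of size `#I_p + o`» (`S_mem`), and the L-image «complement both,
absorber of size `#I_p + o'`, `o' = c_o + δ_o − s_o`» under the three blocked facts (`L_mem`).  All images have corank
`x + δ` and rank `≥ hi + 1`.  No `def`, no `instance`, no notation.  Axioms: standard.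
-/

namespace PercRepro

namespace TwoFlatPLD

open Finset

section Basics

variable {γ : Type} [DecidableEq γ]

/-- `#(F ∖ I ∖ D) = #F − #I − #D` for `I ⊆ F`, `D ⊆ F ∖ I`. -/
theorem card_sdiff_sdiff_eq {F I D : Finset γ} (hI : I ⊆ F) (hD : D ⊆ F \ I) :
    ((F \ I) \ D).card = F.card - I.card - D.card := by
  rw [card_sdiff_of_subset hD, card_sdiff_of_subset hI]

omit [DecidableEq γ] in
/-- A selector with `#J X = min #X s` is the identity on sets of size `≤ s`. -/
theorem selector_eq_self {s : ℕ} {J : Finset γ → Finset γ} {X : Finset γ}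
    (h1 : J X ⊆ X) (h2 : (J X).card = min X.card s) (hX : X.card ≤ s) : J X = X :=
  eq_of_subset_of_card_le h1 (by rw [h2]; omega)

/-- `F ∖ (F ∖ I ∖ D) = I ∪ D` for `I ⊆ F`, `D ⊆ F ∖ I`. -/
theorem sdiff_sdiff_sdiff_eq_union {F I D : Finset γ} (hI : I ⊆ F) (hD : D ⊆ F \ I) :
    F \ ((F \ I) \ D) = I ∪ D := by
  ext x
  simp only [mem_sdiff, mem_union, not_and, not_not]
  constructor
  · intro ⟨hxF, h⟩
    by_cases hxI : x ∈ I
    · exact Or.inl hxI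
    · exact Or.inr (h ⟨hxF, hxI⟩)
  · rintro (hxI | hxD)
    · exact ⟨hI hxI, fun h => absurd hxI h.2⟩
    · have := hD hxD
      rw [mem_sdiff] at this
      exact ⟨this.1, fun _ => hxD⟩

/-- `#(I ∪ D) = #I + #D` for `D ⊆ F ∖ I`. -/
theorem card_union_of_subset_sdiff {F I D : Finset γ} (hD : D ⊆ F \ I) :
    (I ∪ D).card = I.card + D.card := by
  rw [card_union_of_disjoint]
  exact disjoint_of_subset_right hD sdiff_disjoint.symm

end Basics

section Generic

variable {γ γ' : Type} [DecidableEq γ] [DecidableEq γ']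

/-- **Residuality facts** for an overflowing flat `o` with partner `p`: the partner has room
`#I_p + o + δ_p < s_p` and `2·#I_p + o + δ_p < #F_p` (`o = c_o + δ_o − f_o ≥ 1`). -/
theorem residual_facts {k_o i_o s_o δ_o k_p i_p s_p δ_p hi δ : ℕ}
    (hδ : δ_o + δ_p = δ) (hx : min i_o s_o + min i_p s_p ≤ hi)
    (hf : hi + δ + 1 ≤ min (k_o - i_o) s_o + min (k_p - i_p) s_p)
    (hov : s_o < min i_o s_o + δ_o) (hio : i_o ≤ k_o) (hip : i_p ≤ k_p) :
    i_p + (min i_o s_o + δ_o - min (k_o - i_o) s_o) + δ_p < s_p ∧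
      2 * i_p + (min i_o s_o + δ_o - min (k_o - i_o) s_o) + δ_p < k_p ∧
      min i_p s_p = i_p ∧ 1 ≤ min i_o s_o + δ_o - min (k_o - i_o) s_o := by
  omega

omit [DecidableEq γ] in
/-- **S-membership**: the S-image `(I_o, D_o; (F_p ∖ Y) ∖ D_p, D_p)` of a residual source overflowing on `o`,
with `Y ⊆ F_p ∖ D_p` of size `#I_p + o`, lies in `THI`: its `D`-parts are kept points, its corank is `x + δ`,
its rank is `≥ hi + 1`. -/
theorem S_mem (F_o : Finset γ) (s_o : ℕ)
    (F_p : Finset γ') (s_p : ℕ) (J_p : Finset γ' → Finset γ')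
    (hJ_p : ∀ X, J_p X ⊆ X) (hc_p : ∀ X, (J_p X).card = min X.card s_p)
    {lo hi δ : ℕ} {I_o D_o : Finset γ} {I_p D_p : Finset γ'}
    (hIo : I_o ⊆ F_o)
    (hIp : I_p ⊆ F_p) (hDp : D_p ⊆ J_p (F_p \ I_p))
    (hδ : D_o.card + D_p.card = δ)
    (hx_lo : lo ≤ min I_o.card s_o + min I_p.card s_p) (hx_hi : min I_o.card s_o + min I_p.card s_p ≤ hi)
    (hf : hi + δ + 1 ≤ min (F_o.card - I_o.card) s_o + min (F_p.card - I_p.card) s_p)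
    (hov : s_o < min I_o.card s_o + D_o.card)
    {Y : Finset γ'} (hY : Y ⊆ F_p \ D_p)
    (hYc : Y.card = I_p.card + (min I_o.card s_o + D_o.card - min (F_o.card - I_o.card) s_o)) :
    (F_p \ Y) \ D_p ⊆ F_p ∧ D_p ⊆ J_p (F_p \ ((F_p \ Y) \ D_p)) ∧
      lo + δ ≤ min (F_o.card - I_o.card) s_o + min (F_p.card - ((F_p \ Y) \ D_p).card) s_p ∧
      min (F_o.card - I_o.card) s_o + min (F_p.card - ((F_p \ Y) \ D_p).card) s_p ≤ hi + δ ∧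
      hi + 1 ≤ min I_o.card s_o + min ((F_p \ Y) \ D_p).card s_p := by
  have hio : I_o.card ≤ F_o.card := card_le_card hIo
  have hip : I_p.card ≤ F_p.card := card_le_card hIp
  have hDpF : D_p ⊆ F_p \ I_p := hDp.trans (hJ_p _)
  obtain ⟨h1, h2, h3, h4⟩ := residual_facts (k_o := F_o.card) (i_o := I_o.card) (s_o := s_o) (δ_o := D_o.card)
    (k_p := F_p.card) (i_p := I_p.card) (s_p := s_p) (δ_p := D_p.card) hδ hx_hi hf hov hio hip
  have hYF : Y ⊆ F_p := hY.trans sdiff_subset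
  have hDpY : D_p ⊆ F_p \ Y := by
    intro d hd
    rw [mem_sdiff]
    refine ⟨(mem_sdiff.1 (hDpF hd)).1, ?_⟩
    intro hdY
    have := hY hdY
    rw [mem_sdiff] at this
    exact this.2 hd
  have hcard : ((F_p \ Y) \ D_p).card = F_p.card - Y.card - D_p.card := card_sdiff_sdiff_eq hYF hDpY
  have hcompl : F_p \ ((F_p \ Y) \ D_p) = Y ∪ D_p := sdiff_sdiff_sdiff_eq_union hYF hDpY
  have hYD : (Y ∪ D_p).card = Y.card + D_p.card := card_union_of_subset_sdiff hDpY
  have hsel : J_p (Y ∪ D_p) = Y ∪ D_p :=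
    selector_eq_self (hJ_p _) (hc_p _) (by rw [hYD, hYc]; omega)
  refine ⟨sdiff_subset.trans sdiff_subset, ?_, ?_, ?_, ?_⟩
  · rw [hcompl, hsel]; exact subset_union_right
  · rw [hcard]; omega
  · rw [hcard]; omega
  · rw [hcard]; omega

/-- **L-membership**: the L-image `((F_o ∖ I_o) ∖ D_o, D_o; (F_p ∖ Y) ∖ D_p, D_p)` of a BLOCKED residual source
overflowing on `o` (`Y ⊆ F_p ∖ D_p` of size `#I_p + o'`, `o' = c_o + δ_o − s_o`) lies in `THI`.  The blocked facts
used: `#F_o − #I_o ≤ s_o` (the flat-`o` part of `C` does not overflow), `D_o ⊆ J_o (I_o ∪ D_o)`, and the corank of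
`C`, `s_o + min(#F_p − #I_p − o, s_p) ≥ hi + δ + 1`. -/
theorem L_mem (F_o : Finset γ) (s_o : ℕ) (J_o : Finset γ → Finset γ)
    (F_p : Finset γ') (s_p : ℕ) (J_p : Finset γ' → Finset γ')
    (hJ_p : ∀ X, J_p X ⊆ X) (hc_p : ∀ X, (J_p X).card = min X.card s_p)
    {lo hi δ : ℕ} {I_o D_o : Finset γ} {I_p D_p : Finset γ'}
    (hIo : I_o ⊆ F_o) (hDoF : D_o ⊆ F_o \ I_o)
    (hIp : I_p ⊆ F_p) (hDp : D_p ⊆ J_p (F_p \ I_p))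
    (hδ : D_o.card + D_p.card = δ)
    (hx_lo : lo ≤ min I_o.card s_o + min I_p.card s_p) (hx_hi : min I_o.card s_o + min I_p.card s_p ≤ hi)
    (hf : hi + δ + 1 ≤ min (F_o.card - I_o.card) s_o + min (F_p.card - I_p.card) s_p)
    (hov : s_o < min I_o.card s_o + D_o.card)
    (hB1 : F_o.card - I_o.card ≤ s_o) (hB2 : D_o ⊆ J_o (I_o ∪ D_o))
    (hB3 : hi + δ + 1 ≤ s_o +
      min (F_p.card - (I_p.card + (min I_o.card s_o + D_o.card - min (F_o.card - I_o.card) s_o))) s_p)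
    {Y : Finset γ'} (hY : Y ⊆ F_p \ D_p)
    (hYc : Y.card = I_p.card + (min I_o.card s_o + D_o.card - s_o)) :
    (F_o \ I_o) \ D_o ⊆ F_o ∧ D_o ⊆ J_o (F_o \ ((F_o \ I_o) \ D_o)) ∧
      (F_p \ Y) \ D_p ⊆ F_p ∧ D_p ⊆ J_p (F_p \ ((F_p \ Y) \ D_p)) ∧
      lo + δ ≤ min (F_o.card - ((F_o \ I_o) \ D_o).card) s_o + min (F_p.card - ((F_p \ Y) \ D_p).card) s_p ∧
      min (F_o.card - ((F_o \ I_o) \ D_o).card) s_o + min (F_p.card - ((F_p \ Y) \ D_p).card) s_p ≤ hi + δ ∧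
      hi + 1 ≤ min ((F_o \ I_o) \ D_o).card s_o + min ((F_p \ Y) \ D_p).card s_p := by
  have hio : I_o.card ≤ F_o.card := card_le_card hIo
  have hip : I_p.card ≤ F_p.card := card_le_card hIp
  have hDpF : D_p ⊆ F_p \ I_p := hDp.trans (hJ_p _)
  obtain ⟨h1, h2, h3, h4⟩ := residual_facts (k_o := F_o.card) (i_o := I_o.card) (s_o := s_o) (δ_o := D_o.card)
    (k_p := F_p.card) (i_p := I_p.card) (s_p := s_p) (δ_p := D_p.card) hδ hx_hi hf hov hio hip
  have hDoc : D_o.card ≤ F_o.card - I_o.card := by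
    have := card_le_card hDoF
    rwa [card_sdiff_of_subset hIo] at this
  have hYF : Y ⊆ F_p := hY.trans sdiff_subset
  have hDpY : D_p ⊆ F_p \ Y := by
    intro d hd
    rw [mem_sdiff]
    refine ⟨(mem_sdiff.1 (hDpF hd)).1, ?_⟩
    intro hdY
    have := hY hdY
    rw [mem_sdiff] at this
    exact this.2 hd
  have hcard_p : ((F_p \ Y) \ D_p).card = F_p.card - Y.card - D_p.card := card_sdiff_sdiff_eq hYF hDpY
  have hcompl_p : F_p \ ((F_p \ Y) \ D_p) = Y ∪ D_p := sdiff_sdiff_sdiff_eq_union hYF hDpY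
  have hYD : (Y ∪ D_p).card = Y.card + D_p.card := card_union_of_subset_sdiff hDpY
  have hsel : J_p (Y ∪ D_p) = Y ∪ D_p :=
    selector_eq_self (hJ_p _) (hc_p _) (by rw [hYD, hYc]; omega)
  have hcard_o : ((F_o \ I_o) \ D_o).card = F_o.card - I_o.card - D_o.card := card_sdiff_sdiff_eq hIo hDoF
  have hcompl_o : F_o \ ((F_o \ I_o) \ D_o) = I_o ∪ D_o := sdiff_sdiff_sdiff_eq_union hIo hDoF
  have hIoD : (I_o ∪ D_o).card = I_o.card + D_o.card := card_union_of_subset_sdiff hDoF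
  have hFo : F_o.card = ((F_o \ I_o) \ D_o).card + (I_o ∪ D_o).card := by
    rw [hcard_o, hIoD]; omega
  refine ⟨sdiff_subset.trans sdiff_subset, ?_, sdiff_subset.trans sdiff_subset, ?_, ?_, ?_, ?_⟩
  · rw [hcompl_o]; exact hB2
  · rw [hcompl_p, hsel]; exact subset_union_right
  · rw [hcard_p, hcard_o]; omega
  · rw [hcard_p, hcard_o]; omega
  · rw [hcard_p, hcard_o]; omega

/-- **N-membership, per flat**: for a non-overflowing part `(I, D)` (`c + δ ≤ s`), the complemented part
`((F ∖ I) ∖ D, D)` has kept `D`, corank contribution `c + δ` and rank contribution `≥ f − δ`. -/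
theorem N_flat {F : Finset γ} {s : ℕ} {J : Finset γ → Finset γ}
    (hJ : ∀ X, J X ⊆ X) (hc : ∀ X, (J X).card = min X.card s)
    {I D : Finset γ} (hI : I ⊆ F) (hD : D ⊆ J (F \ I)) (hnov : min I.card s + D.card ≤ s) :
    (F \ I) \ D ⊆ F ∧ D ⊆ J (F \ ((F \ I) \ D)) ∧
      min (F.card - ((F \ I) \ D).card) s = min I.card s + D.card ∧
      min (F.card - I.card) s ≤ min ((F \ I) \ D).card s + D.card := by
  have hDF : D ⊆ F \ I := hD.trans (hJ _)
  have hio : I.card ≤ F.card := card_le_card hI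
  have hDc : D.card ≤ F.card - I.card := by
    have := card_le_card hDF
    rwa [card_sdiff_of_subset hI] at this
  have hcard : ((F \ I) \ D).card = F.card - I.card - D.card := card_sdiff_sdiff_eq hI hDF
  have hcompl : F \ ((F \ I) \ D) = I ∪ D := sdiff_sdiff_sdiff_eq_union hI hDF
  have hID : (I ∪ D).card = I.card + D.card := card_union_of_subset_sdiff hDF
  refine ⟨sdiff_subset.trans sdiff_subset, ?_, ?_, ?_⟩
  · rw [hcompl]
    by_cases hsmall : I.card + D.card ≤ s
    · rw [selector_eq_self (hJ _) (hc _) (by rw [hID]; exact hsmall)]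
      exact subset_union_right
    · -- then `#I > s` and `D = ∅`
      have hD0 : D.card = 0 := by omega
      rw [card_eq_zero] at hD0
      rw [hD0]; exact empty_subset _
  · rw [hcard]; omega
  · rw [hcard]; omega

/-- Complement cancellation: `(F ∖ I) ∖ D = (F ∖ I') ∖ D` forces `I = I'` for `I, I' ⊆ F` and `D ⊆ F ∖ I`, `D ⊆ F ∖ I'`. -/
theorem eq_of_sdiff_sdiff_eq {F I I' D : Finset γ} (hI : I ⊆ F) (hI' : I' ⊆ F) (hD : D ⊆ F \ I) (hD' : D ⊆ F \ I')
    (h : (F \ I) \ D = (F \ I') \ D) : I = I' := by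
  have h1 : F \ ((F \ I) \ D) = F \ ((F \ I') \ D) := by rw [h]
  rw [sdiff_sdiff_sdiff_eq_union hI hD, sdiff_sdiff_sdiff_eq_union hI' hD'] at h1
  have d1 : Disjoint I D := disjoint_of_subset_right hD sdiff_disjoint.symm
  have d2 : Disjoint I' D := disjoint_of_subset_right hD' sdiff_disjoint.symm
  have h2 : (I ∪ D) \ D = (I' ∪ D) \ D := by rw [h1]
  rwa [union_sdiff_cancel_right d1, union_sdiff_cancel_right d2] at h2

/-- If `I = (F ∖ I') ∖ D` then `(F ∖ I) ∖ D = I'` (`I' ⊆ F`, `D ⊆ F ∖ I'`). -/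
theorem sdiff_sdiff_of_eq {F I I' D : Finset γ} (hI' : I' ⊆ F) (hD' : D ⊆ F \ I') (h : I = (F \ I') \ D) :
    (F \ I) \ D = I' := by
  rw [h, sdiff_sdiff_sdiff_eq_union hI' hD']
  exact union_sdiff_cancel_right (disjoint_of_subset_right hD' sdiff_disjoint.symm)

/-- **Heredity of the kept points**: `D ⊆ J (F ∖ I)` and `I ⊆ Y ⊆ F ∖ D` give `D ⊆ J (F ∖ Y)`. -/
theorem kept_of_subset {F I Y D : Finset γ} {J : Finset γ → Finset γ}
    (hJ : ∀ X, J X ⊆ X) (hh : ∀ X X', X' ⊆ X → J X ∩ X' ⊆ J X')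
    (hD : D ⊆ J (F \ I)) (hIY : I ⊆ Y) (hY : Y ⊆ F \ D) : D ⊆ J (F \ Y) := by
  intro d hd
  have hsub : F \ Y ⊆ F \ I := sdiff_subset_sdiff subset_rfl hIY
  apply hh (F \ I) (F \ Y) hsub
  rw [mem_inter, mem_sdiff]
  refine ⟨hD hd, (mem_sdiff.1 (hJ _ (hD hd))).1, ?_⟩
  intro hdY
  exact (mem_sdiff.1 (hY hdY)).2 hd

end Generic

end TwoFlatPLD

end PercRepro
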